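import Mathlib
import HarnessLib.Audit
import Summits.PneNP.PneNP.Theorems.PstarGateUnitCycleAffine
import Summits.PneNP.PneNP.Theorems.PstarGateDirection

/-!
# One GATED chord, node N5: what (T3) says on the gate chamber where the gated chord is OFF — the companion chord is ON and the second constraint is pinned (E2; prover-1 g19)

FRONTIER range-avoidance ladder, rung F-N3 (`stmt-PneNP-19007`), cell `pnp-ideate` (`PstarGateNodesX.GateU2X`); restricted-model proof complexity —
nothing here bears on `P` versus `NP`.

`N = {e, e'}`, `e` gated (`ρ_e = (ℓ, 0)`, `ρ'_e = 0`), `e'` doubly read with constant independent reads `r, r'`.  At a base point of the gate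
chamber `H₁ = {ℓ = 1}` where the gated chord is killable (`u_e = 0`), its first private is a FREE bit of the first constraint, so (T3) says the
SECOND coordinate alone is unreachable over the admissible states:

* `unreach_snd_of_gate_off` — MODEL: infeasible, `ρ_e(a) = (1,0)`, `ρ'_e(a) = 0`, `u_e(a) = 0` ⟹ no admissible state hits the second target
  coordinate at `a`;
* `u2_off` — INSTANCE: for one-gate bridge data with `N = {e, e'}`, `e'` doubly read: **on `H₁ ∩ Z(u_e)` the companion chord is ON
  (`u_{e'} = 1`) and `q_{(1,0)} = r₂ + r'₂ + 1`** (`PstarGateDirection.unread_of_unreach_snd`: a killable `e'` would be unread by the second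
  constraint, but one of `r, r'` has second coordinate `1`; `snd_eq_of_unreach_snd` for the value).  The first half is the separation
  `PstarGateFibre.sep_of_U2`; the second pins the second constraint's state-free form on the OFF-region of the chamber.
-/

set_option linter.dupNamespace false -- `Summit.PneNP.PneNP.…`: summit = sub-problem name (D-0017 single-conjunct layout)

open Finset Literature.Computability.Complexity
open Summit.PneNP.PneNP.Theorems.PstarTyped (Typed)
open Summit.PneNP.PneNP.Theorems.PstarSALevel (BoundaryExpanding SimpleOverlap)
open Summit.PneNP.PneNP.Theorems.PstarReadSumset (V2)
open Summit.PneNP.PneNP.Theorems.PstarChordSystem (ChordSystem)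
open Summit.PneNP.PneNP.Theorems.PstarChordBridgeTools (privs coef)
open Summit.PneNP.PneNP.Theorems.PstarChordBridge (BridgeData sys Solution Lift infeasible_of_not_solution)
open Summit.PneNP.PneNP.Theorems.PstarChordBridgeBasis (qDir)
open Summit.PneNP.PneNP.Theorems.PstarGateBridge (GateHyp gate_reads const_of_others)
open Summit.PneNP.PneNP.Theorems.PstarGateDirection (unread_of_unreach_snd snd_eq_of_unreach_snd)
open Summit.PneNP.PneNP.Theorems.PstarGateNodes (GateData)
open Summit.PneNP.PneNP.Theorems.PstarGateNodesX (GateDataX)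
open Summit.PneNP.PneNP.Theorems.PstarGateUnitCycleAffine (qDir_one_zero)

namespace Summit.PneNP.PneNP.Theorems.PstarGateU2Off

/-! ## Model -/

section Model

variable {ι A : Type*} [DecidableEq ι] (S : ChordSystem ι A)

/-- **Where the gated chord is killable and read as `(1,0)`, the second target coordinate is unreachable.**  (Its first private repairs the
first coordinate of any admissible state hitting the second.) -/
theorem unreach_snd_of_gate_off {E : Finset ι} (hI : S.Infeasible E) {e : ι} (he : e ∈ E) {a : A} (hρ : S.ρ e a = (1, 0))
    (hρ' : S.ρ' e a = 0) (hue : S.u e a = 0) : ∀ s, S.Adm E a s → (S.val E a s).2 ≠ S.t.2 := by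
  intro s hadm h2
  set π : ZMod 2 := (s e).1 + (S.val E a s).1 + S.t.1 with hπ
  refine hI a (Function.update s e (π, 0)) (S.adm_update (S.adm_erase hadm e) (by rw [mul_zero, hue])) ?_
  have hsplit := S.val_eq he a s
  have hce : S.contrib a s e = ((s e).1, 0) := by
    unfold ChordSystem.contrib
    rw [hρ, hρ', smul_zero, add_zero]
    ext <;> simp
  rw [S.val_eq he, S.val_erase_update, S.contrib_update_self, hρ, hρ', smul_zero, add_zero]
  rw [hce] at hsplit
  ext
  · have h1 := congrArg Prod.fst hsplit
    simp only [Prod.fst_add] at h1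
    simp only [Prod.fst_add, Prod.smul_fst, smul_eq_mul, mul_one, hπ]
    rw [h1]
    generalize (s e).1 = b; generalize (S.val (E.erase e) a s).1 = c; generalize S.t.1 = d
    revert b c d; decide
  · have h2' := congrArg Prod.snd hsplit
    simp only [Prod.snd_add, zero_add] at h2'
    simp only [Prod.snd_add, Prod.smul_snd, smul_eq_mul, mul_zero, zero_add]
    rw [← h2', h2]

end Model

/-! ## Instance -/

variable {n m : ℕ}

/-- **On the OFF-region of the gate chamber the companion chord is ON and `q_{(1,0)}` is pinned.** -/
theorem u2_off (I : LocalMap 4 n m) (hI : I.IsPure xorAndPred) (hT : Typed I) {r₀ : ℕ} {B : BridgeData n m} {e g₀ : Fin m} {u : Fin n}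
    {κ₀ : ZMod 2} (hD : GateDataX I r₀ B e g₀ u κ₀) {e' : Fin m} (hN : B.N = {e, e'}) (hne : e' ≠ e)
    (hU2 : ∀ a, (sys I B).ρ e' a ≠ 0 ∧ (sys I B).ρ' e' a ≠ 0 ∧ (sys I B).ρ e' a ≠ (sys I B).ρ' e' a)
    {x : Fin n → ZMod 2} (hc : coef I B.C₁ B.G₁ (I.vars e 2) x = 1) (hue : (sys I B).u e x = 0) :
    (sys I B).u e' x = 1 ∧ qDir I B (1, 0) x = ((sys I B).ρ e' 0).2 + ((sys I B).ρ' e' 0).2 + 1 := by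
  classical
  obtain ⟨-, hW, -, -, -, hL, -, -, hG, -, -, -, -, -, -, -, hT3, -⟩ := id hD
  have he : e ∈ B.N := hG.1
  have he' : e' ∈ B.N := by rw [hN]; exact mem_insert_of_mem (mem_singleton_self _)
  have hinf : (sys I B).Infeasible B.N := infeasible_of_not_solution I hI hT hW hL hT3
  have hρ : (sys I B).ρ e x = (1, 0) := by rw [(gate_reads I hI hG x).1, hc]
  have hρ' : (sys I B).ρ' e x = 0 := (gate_reads I hI hG x).2
  have hno := unreach_snd_of_gate_off (sys I B) hinf he hρ hρ' hue
  have hconst := const_of_others I hW hG e' he' hne x 0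
  -- the companion chord is ON
  have hu' : (sys I B).u e' x = 1 := by
    rcases (show (sys I B).u e' x = 0 ∨ (sys I B).u e' x = 1 by
        generalize (sys I B).u e' x = t; revert t; decide) with h0 | h1
    · exfalso
      obtain ⟨h2, h2'⟩ := unread_of_unreach_snd (sys I B) hno he' h0
      rw [hconst.1] at h2
      rw [hconst.2] at h2'
      obtain ⟨hr, hr', hrr'⟩ := hU2 0
      revert hr hr' hrr' h2 h2'
      generalize (sys I B).ρ e' 0 = v; generalize (sys I B).ρ' e' 0 = w
      rcases v with ⟨v1, v2⟩; rcases w with ⟨w1, w2⟩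
      simp only [ne_eq, Prod.mk.injEq, Prod.mk_eq_zero, not_and]
      revert v1 v2 w1 w2; decide
    · exact h1
  refine ⟨hu', ?_⟩
  -- the second-coordinate identity on the ON-set `{e'}`
  have hsnd := snd_eq_of_unreach_snd (sys I B) hno
  have hfilter : B.N.filter (fun i => ¬ (sys I B).u i x = 0) = {e'} := by
    ext i
    rw [hN, mem_filter, mem_insert, mem_singleton]
    constructor
    · rintro ⟨hi | hi, hu⟩
      · subst hi; exact absurd hue hu
      · exact hi
    · intro hi; subst hi; exact ⟨Or.inr rfl, by rw [hu']; exact one_ne_zero⟩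
  rw [hfilter, sum_singleton, hconst.1, hconst.2] at hsnd
  rw [qDir_one_zero]
  have h := hsnd
  simp only [Prod.snd_add] at h
  have e3 : ∀ f a b t : ZMod 2, f + (a + b) = t + 1 → f + t = a + b + 1 := by decide
  exact e3 _ _ _ _ h

end Summit.PneNP.PneNP.Theorems.PstarGateU2Off
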